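import Mathlib
import HarnessLib
import Literature.MathematicalPhysics.StatisticalMechanics.TorusPolymerTranslations

/-!
# Connected polymers on the torus: blocks are connected, components of polymers are polymers,
# the diameter of a connected set, freeness of coarse translations on small polymers

Geometric facts about the paving of `Λ = (ℤ/M)^d` by centred blocks of odd side `s`
(`TorusPolymer.blockOf`) that the reblocking map `π : 𝓟_k → 𝓟_{k+1}` of
Adams–Buchholz–Kotecký–Müller ([ABKM19] Ch. 6.3, (6.25)–(6.26)) and Lemma 6.4 rest on, with
`ℓ^∞`-connectedness from `Literature.Barriers.CriticalPhenomena.LongRangePhi4.Polymer`.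

* **centred blocks are connected** (`connIn_blockOf`, `isConn_blockOf`; odd torus, odd side;
  monotone coordinate paths between symmetric representatives), hence **the connected components
  of a `k`-polymer are `k`-polymers** (`IsPolymer.comp`, `IsPolymer.of_mem_components`) —
  [ABKM19] `𝓒(X) ⊆ 𝓟_k`, needed for `π(X) = ⋃_{Y ∈ 𝓒(X)} π(Y)` (6.26);
* **diameter of connected sets** (`supNorm_sub_lt_of_connIn`, `supNorm_sub_lt_of_isConn`): if
  `x, y` are joined inside `X` then `|x − y|_∞ + 1 ≤ |𝓑_k(X)|·s` — a connected set meeting `m`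
  blocks has diameter `≤ m s − 1` (leave the first block for the last time, then induct on the
  number of blocks, after a frontier-crossing step); for a small
  polymer (`m ≤ 2^d`) this is [ABKM19] (6.27);
* **freeness** (`eq_zero_of_translate_eq`): a connected set meeting `m` blocks of side `s` with
  `m·s ≤ s'` is moved by every non-zero `a ∈ (s'ℤ)^d` — `(L^{k+1}ℤ)^d` acts freely on the small
  `k`-polymers once `L ≥ 2^d`, which makes a choice of orbit representatives (the lexicographic
  choice of [ABKM19] after (6.25)) extend to a translation-covariant `π`.

Everything is proved; no named fact.

## References
* S. Adams, S. Buchholz, R. Kotecký, S. Müller, arXiv:1910.13564, Ch. 6.2 (connected polymers,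
  `𝓒(X)`, small polymers, (6.27)), Ch. 6.3 ((6.25)–(6.26)) [AdamsBuchholzKoteckyMuller2019].
* S. Adams, R. Kotecký, S. Müller, arXiv:1606.09541, Ch. 4 [AdamsKoteckyMuller2016].
-/

noncomputable section

namespace Literature.MathematicalPhysics.StatisticalMechanics.TorusPolymer

open scoped BigOperators Classical
open Finset
open Literature.MathematicalPhysics.StatisticalMechanics.GradientFRD
  (natAbs_valMinAbs_le_supNorm supNorm_add_le supNorm_neg supNorm_eq_zero_iff)
open Literature.Barriers.CriticalPhenomena.LongRangePhi4.Polymer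
  (AdjInf ConnIn IsConn comp components mem_comp comp_subset mem_comp_self)

variable {d M : ℕ}

/-! ## Centred blocks are connected -/

section Blocks

variable [NeZero M]

/-- One step up in coordinate `i` inside a centred block (odd `M`, odd `s`): if `x, y ∈ B` and the
symmetric representative of `x_i` is below that of `y_i`, then `x + e_i ∈ B`, `|e_i|_∞ = 1`, and
the representative goes up by one. [cite: AdamsKoteckyMuller2016, Ch. 4] -/
theorem step_mem_blockOf (hM : Odd M) {s : ℕ} (hs : Odd s) {x y : Fin d → ZMod M}
    (hy : y ∈ blockOf s x) (i : Fin d) (hlt : (x i).valMinAbs < (y i).valMinAbs) :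
    Function.update x i (x i + 1) ∈ blockOf s x ∧ AdjInf x (Function.update x i (x i + 1)) ∧
      (Function.update x i (x i + 1) i).valMinAbs = (x i).valMinAbs + 1 := by
  have hyi := natAbs_valMinAbs_le_half hM (y i)
  have hxi := natAbs_valMinAbs_le_half hM (x i)
  have hM3 : 3 ≤ M := by
    obtain ⟨m, rfl⟩ := hM
    have : (x i).valMinAbs < (y i).valMinAbs := hlt
    omega
  have hval : (x i + 1).valMinAbs = (x i).valMinAbs + 1 := by
    have h1 : (x i + 1 : ZMod M) = (((x i).valMinAbs + 1 : ℤ) : ZMod M) := by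
      simp [ZMod.coe_valMinAbs]
    rw [h1]
    apply valMinAbs_intCast_of_abs_le
    rw [abs_le]
    have hMm : (((M : ℤ)) - 1) / 2 = (((M - 1) / 2 : ℕ) : ℤ) := by
      obtain ⟨m, rfl⟩ := hM; push_cast; omega
    rw [hMm]
    constructor <;> omega
  refine ⟨?_, ?_, by simp [hval]⟩
  · rw [mem_blockOf] at hy ⊢
    intro i'
    by_cases hi : i' = i
    · subst hi
      rw [cubeIndex_eq_resIndex, cubeIndex_eq_resIndex]
      simp only [Function.update_self]
      have hxr := (resIndex_eq_iff hs (x i') (resIndex s (x i'))).1 rfl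
      have hyr := (resIndex_eq_iff hs (y i') (resIndex s (x i'))).1
        (by have := hy i'; rw [cubeIndex_eq_resIndex, cubeIndex_eq_resIndex] at this; exact this.symm)
      symm
      rw [resIndex_eq_iff hs, hval]
      constructor <;> omega
    · have := hy i'
      simp only [cubeIndex, Function.update_of_ne hi]
  · refine ⟨fun h => ?_, fun i' => ?_⟩
    · have := congrFun h i
      simp only [Function.update_self] at this
      have h2 := congrArg ZMod.valMinAbs this
      rw [hval] at h2
      omega
    · by_cases hi : i' = i
      · subst hi; exact Or.inr (Or.inl (by simp))
      · exact Or.inl (by simp [Function.update_of_ne hi])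

/-- **Centred blocks are connected**: any two points of a block are joined inside it (odd torus,
odd side; monotone coordinate paths between symmetric representatives).
[cite: AdamsKoteckyMuller2016, Ch. 4] -/
theorem connIn_blockOf (hM : Odd M) {s : ℕ} (hs : Odd s) {x y : Fin d → ZMod M}
    (hy : y ∈ blockOf s x) : ConnIn (blockOf s x) x y := by
  suffices H : ∀ (D : ℕ) (x y : Fin d → ZMod M), y ∈ blockOf s x →
      ∑ i, ((x i).valMinAbs - (y i).valMinAbs).natAbs = D → ConnIn (blockOf s x) x y from
    H _ x y hy rfl
  intro D
  induction D using Nat.strong_induction_on with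
  | _ D ih =>
    intro x y hy hD
    by_cases hxy : x = y
    · subst hxy; exact Relation.ReflTransGen.refl
    · obtain ⟨i, hi⟩ : ∃ i, (x i).valMinAbs ≠ (y i).valMinAbs := by
        by_contra h
        push Not at h
        exact hxy (funext fun i => by
          have := congrArg (fun z : ℤ => (z : ZMod M)) (h i)
          simpa [ZMod.coe_valMinAbs] using this)
      rcases lt_or_gt_of_ne hi with hlt | hgt
      · obtain ⟨hx'B, hadj, hval⟩ := step_mem_blockOf hM hs hy i hlt
        set x' := Function.update x i (x i + 1) with hx'
        have hBB : blockOf s x' = blockOf s x := blockOf_eq_of_mem hx'B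
        have hyB' : y ∈ blockOf s x' := by rw [hBB]; exact hy
        have hstep : ConnIn (blockOf s x) x x' :=
          Relation.ReflTransGen.single ⟨mem_blockOf_self s x, hx'B, hadj⟩
        have hdec : ∑ i, ((x' i).valMinAbs - (y i).valMinAbs).natAbs < D := by
          rw [← hD]
          apply Finset.sum_lt_sum
          · intro i' _
            by_cases hii : i' = i
            · subst hii; rw [hval]; omega
            · simp [hx', Function.update_of_ne hii]
          · exact ⟨i, mem_univ i, by rw [hval]; omega⟩
        have := ih _ hdec x' y hyB' rfl
        rw [hBB] at this
        exact hstep.trans this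
      · have hx : x ∈ blockOf s y := by rw [blockOf_eq_of_mem hy]; exact mem_blockOf_self s x
        obtain ⟨hy'B, hadj, hval⟩ := step_mem_blockOf hM hs hx i hgt
        set y' := Function.update y i (y i + 1) with hy'
        have hBy : blockOf s y = blockOf s x := blockOf_eq_of_mem hy
        have hy'Bx : y' ∈ blockOf s x := by rw [← hBy]; exact hy'B
        have hstep : ConnIn (blockOf s x) y y' := Relation.ReflTransGen.single ⟨hy, hy'Bx, hadj⟩
        have hdec : ∑ i, ((x i).valMinAbs - (y' i).valMinAbs).natAbs < D := by
          rw [← hD]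
          apply Finset.sum_lt_sum
          · intro i' _
            by_cases hii : i' = i
            · subst hii; rw [hval]; omega
            · simp [hy', Function.update_of_ne hii]
          · exact ⟨i, mem_univ i, by rw [hval]; omega⟩
        have := ih _ hdec x y' hy'Bx rfl
        exact this.trans hstep.symm

/-- Centred blocks are connected sets. [cite: AdamsKoteckyMuller2016, Ch. 4] -/
theorem isConn_blockOf (hM : Odd M) {s : ℕ} (hs : Odd s) (x : Fin d → ZMod M) : IsConn (blockOf s x) := by
  refine ⟨⟨x, mem_blockOf_self s x⟩, fun y hy z hz => ?_⟩
  have hyB : blockOf s y = blockOf s x := blockOf_eq_of_mem hy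
  have hz' : z ∈ blockOf s y := by rw [hyB]; exact hz
  have := connIn_blockOf hM hs hz'
  rwa [hyB] at this

/-- **The connected components of a polymer are polymers** (`𝓒(X) ⊆ 𝓟_k` for `X ∈ 𝓟_k`).
[cite: AdamsBuchholzKoteckyMuller2019, Ch. 6.2] -/
theorem IsPolymer.comp (hM : Odd M) {s : ℕ} (hs : Odd s) {X : Finset (Fin d → ZMod M)}
    (hX : IsPolymer s X) (x : Fin d → ZMod M) : IsPolymer s (comp X x) := by
  intro y hy z hz
  obtain ⟨hyX, hxy⟩ := mem_comp.1 hy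
  refine mem_comp.2 ⟨hX y hyX hz, hxy.trans ?_⟩
  exact (connIn_blockOf hM hs hz).mono (hX y hyX)

/-- Members of `𝓒(X)` are connected polymers for a polymer `X`.
[cite: AdamsBuchholzKoteckyMuller2019, Ch. 6.2] -/
theorem IsPolymer.of_mem_components (hM : Odd M) {s : ℕ} (hs : Odd s) {X Y : Finset (Fin d → ZMod M)}
    (hX : IsPolymer s X) (hY : Y ∈ components X) : IsPolymer s Y ∧ IsConn Y := by
  simp only [components, mem_image] at hY
  obtain ⟨x, hx, rfl⟩ := hY
  exact ⟨hX.comp hM hs x, Literature.Barriers.CriticalPhenomena.LongRangePhi4.Polymer.isConn_comp hx⟩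

end Blocks

/-! ## The diameter of a connected set -/

/-- Frontier crossing: a path from outside `S` to inside `S` has a step from outside to inside.
[folklore] -/
private theorem exists_step_of_reflTransGen {α : Type*} {R : α → α → Prop} {S : Set α} {x y : α}
    (h : Relation.ReflTransGen R x y) (hx : x ∉ S) (hy : y ∈ S) :
    ∃ a c, Relation.ReflTransGen R x a ∧ R a c ∧ a ∉ S ∧ c ∈ S ∧ Relation.ReflTransGen R c y := by
  induction h with
  | refl => exact absurd hy hx
  | @tail b z hxb hbz ih =>
    by_cases hb : b ∈ S
    · obtain ⟨a, c, h1, h2, h3, h4, h5⟩ := ih hb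
      exact ⟨a, c, h1, h2, h3, h4, h5.tail hbz⟩
    · exact ⟨b, z, hxb, hbz, hb, hy, Relation.ReflTransGen.refl⟩

/-- An `ℓ^∞`-step has length one: `AdjInf x y → |x − y|_∞ ≤ 1`.
[cite: AdamsBuchholzKoteckyMuller2019, Ch. 6.2] -/
theorem supNorm_sub_le_one_of_adjInf [NeZero M] {x y : Fin d → ZMod M} (h : AdjInf x y) :
    GradientFRD.supNorm (x - y) ≤ 1 := by
  rw [supNorm_le_iff]
  intro i
  by_cases hM2 : M ≤ 2
  · exact (ZMod.natAbs_valMinAbs_le _).trans (by omega)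
  · have key : ∀ u : ℤ, |u| ≤ 1 → ((u : ZMod M)).valMinAbs = u := fun u hu =>
      valMinAbs_intCast_of_abs_le (hu.trans (by omega))
    simp only [Pi.sub_apply]
    rcases h.2 i with h' | h' | h'
    · rw [h', sub_self, ZMod.valMinAbs_zero]; simp
    · have e : x i - y i = ((-1 : ℤ) : ZMod M) := by rw [h']; push_cast; ring
      rw [e, key (-1) (by simp)]; simp
    · have e : x i - y i = ((1 : ℤ) : ZMod M) := by rw [h']; push_cast; ring
      rw [e, key 1 (by simp)]; simp

/-- Removing the block of `x` removes exactly one element of `𝓑_k(X)`.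
[cite: AdamsBuchholzKoteckyMuller2019, Ch. 6.2] -/
theorem blocks_sdiff_blockOf [NeZero M] (s : ℕ) (X : Finset (Fin d → ZMod M)) (x : Fin d → ZMod M) :
    blocks s (X \ blockOf s x) = (blocks s X).erase (blockOf s x) := by
  ext B
  rw [mem_blocks, mem_erase, mem_blocks]
  constructor
  · rintro ⟨z, hz, rfl⟩
    rw [mem_sdiff] at hz
    refine ⟨fun h => hz.2 ?_, z, hz.1, rfl⟩
    rw [← h]; exact mem_blockOf_self s z
  · rintro ⟨hne, z, hz, rfl⟩
    refine ⟨z, mem_sdiff.2 ⟨hz, fun h => hne (blockOf_eq_of_mem h)⟩, rfl⟩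

/-- **Diameter of connected sets**: if `y` is joined to `x` inside `X` by an `ℓ^∞`-path, then
`|x − y|_∞ + 1 ≤ |𝓑_k(X)|·s` (`s` odd, odd torus): a path meeting `m` blocks of side `s` has
end-to-end distance `≤ m s − 1` (leave the first block for the last time, then induct).  For a
small polymer (`m ≤ 2^d`) this is [ABKM19] (6.27): `X` lies in a cube of side `2^d L^k` about any
of its points. [cite: AdamsBuchholzKoteckyMuller2019, Ch. 6.2 (6.27)] -/
theorem supNorm_sub_lt_of_connIn [NeZero M] {s : ℕ} (hs : Odd s)
    {X : Finset (Fin d → ZMod M)} {x y : Fin d → ZMod M} (hx : x ∈ X) (h : ConnIn X x y) :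
    GradientFRD.supNorm (x - y) + 1 ≤ (blocks s X).card * s := by
  suffices H : ∀ (n : ℕ) (X : Finset (Fin d → ZMod M)) (x y : Fin d → ZMod M), (blocks s X).card = n →
      x ∈ X → ConnIn X x y → GradientFRD.supNorm (x - y) + 1 ≤ n * s from H _ X x y rfl hx h
  intro n
  induction n using Nat.strong_induction_on with
  | _ n ih =>
    intro X x y hn hx h
    have hs1 : 1 ≤ s := by obtain ⟨k, rfl⟩ := hs; omega
    have hBmem : blockOf s x ∈ blocks s X := mem_blocks.2 ⟨x, hx, rfl⟩
    have hn1 : 1 ≤ n := by rw [← hn]; exact card_pos.2 ⟨_, hBmem⟩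
    by_cases hyB : y ∈ blockOf s x
    · -- same block: `|x − y| ≤ s − 1`
      have h1 := supNorm_sub_le_of_sameBlock hs (mem_blockOf.1 hyB)
      calc GradientFRD.supNorm (x - y) + 1 ≤ (s - 1) + 1 := by omega
        _ = 1 * s := by omega
        _ ≤ n * s := Nat.mul_le_mul_right s hn1
    · -- leave `B_x` for the last time
      set S : Set (Fin d → ZMod M) := {z | z ∈ X \ blockOf s x ∧ ConnIn (X \ blockOf s x) z y}
      have hyX : y ∈ X := by
        by_cases hxy : x = y
        · subst hxy; exact hx
        · exact h.mem_of_ne hxy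
      have hyS : y ∈ S := ⟨mem_sdiff.2 ⟨hyX, hyB⟩, Relation.ReflTransGen.refl⟩
      have hxS : x ∉ S := fun h' => (mem_sdiff.1 h'.1).2 (mem_blockOf_self s x)
      obtain ⟨a, c, hxa, hac, haS, hcS, -⟩ := exists_step_of_reflTransGen h hxS hyS
      -- `a ∈ B_x`: otherwise `a ∈ S` via `c`
      have haB : a ∈ blockOf s x := by
        by_contra haB
        apply haS
        refine ⟨mem_sdiff.2 ⟨hac.1, haB⟩, ?_⟩
        exact Relation.ReflTransGen.head ⟨mem_sdiff.2 ⟨hac.1, haB⟩, hcS.1, hac.2.2⟩ hcS.2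
      -- induction hypothesis on `X ∖ B_x`
      have hcard : (blocks s (X \ blockOf s x)).card = n - 1 := by
        rw [blocks_sdiff_blockOf, card_erase_of_mem hBmem, hn]
      have hlt : n - 1 < n := by omega
      have hIH := ih (n - 1) hlt (X \ blockOf s x) c y hcard hcS.1 hcS.2
      have h1 := supNorm_sub_le_of_sameBlock hs (mem_blockOf.1 haB)
      have h2 := supNorm_sub_le_one_of_adjInf hac.2.2
      have h3 : GradientFRD.supNorm (x - y) ≤
          GradientFRD.supNorm (x - a) + (GradientFRD.supNorm (a - c) + GradientFRD.supNorm (c - y)) :=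
        (supNorm_sub_le x a y).trans (Nat.add_le_add_left (supNorm_sub_le a c y) _)
      have h4 : (n - 1) * s + s = n * s := by
        rw [← Nat.succ_mul]; congr 1; omega
      omega

/-- **A connected set meeting at most `m` blocks has diameter `≤ m s − 1`.**
[cite: AdamsBuchholzKoteckyMuller2019, Ch. 6.2 (6.27)] -/
theorem supNorm_sub_lt_of_isConn [NeZero M] {s m : ℕ} (hs : Odd s)
    {X : Finset (Fin d → ZMod M)} (hX : IsConn X) (hm : (blocks s X).card ≤ m)
    {x y : Fin d → ZMod M} (hx : x ∈ X) (hy : y ∈ X) : GradientFRD.supNorm (x - y) + 1 ≤ m * s :=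
  (supNorm_sub_lt_of_connIn hs hx (hX.2 x hx y hy)).trans (Nat.mul_le_mul_right s hm)

/-! ## Freeness of coarse translations on small connected sets -/

/-- **Freeness**: a non-empty connected set meeting `m` blocks of odd side `s` with `m·s ≤ s'`
(`M = s'·t'`) is moved by every non-zero `a ∈ (s'ℤ)^d`: `X + a = X` forces `a = 0`.  With
`s = L^k`, `s' = L^{k+1}`, `m = 2^d ≤ L` this says that `(L^{k+1}ℤ)^d` acts freely on the small
`k`-polymers, so that a choice of representatives modulo these translations (the lexicographic
choice of [ABKM19] after (6.25)) extends to a translation-covariant map.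
[cite: AdamsBuchholzKoteckyMuller2019, Ch. 6.3 (translation invariance of π)] -/
theorem eq_zero_of_translate_eq [NeZero M] {s s' t' m : ℕ} (hs : Odd s)
    (hMst : M = s' * t') (hms : m * s ≤ s') {X : Finset (Fin d → ZMod M)} (hX : IsConn X)
    (hm : (blocks s X).card ≤ m) {a : Fin d → ZMod M} (ha : IsLatticeVec s' a)
    (haX : translate a X = X) : a = 0 := by
  by_contra ha0
  obtain ⟨x, hx⟩ := hX.1
  have hxa : x + a ∈ X := by rw [← haX]; exact add_mem_translate_iff.2 hx
  have h1 := supNorm_sub_lt_of_isConn hs hX hm hxa hx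
  rw [add_sub_cancel_left] at h1
  have h2 := le_supNorm_of_isLatticeVec hMst ha ha0
  omega

end Literature.MathematicalPhysics.StatisticalMechanics.TorusPolymer

end
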